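import Mathlib.Analysis.Calculus.SmoothSeries
import Mathlib.Analysis.Calculus.LocalExtr.Basic
import Mathlib.Analysis.Calculus.Deriv.MeanValue
import Literature.MathematicalPhysics.StatisticalMechanics.Theil2006EnergyBounds
import HarnessLib

/-!
# Theil 2006: Lemma 2.1 (10) and (11) — the renormalized potential is uniformly convex near `1`

Topic: `Literature/MathematicalPhysics/StatisticalMechanics`; companion to `Theil2006.lean`
(F. Theil, *A proof of crystallization in two dimensions*, Comm. Math. Phys. **262** (2006)
209–236; read in the author's accepted preprint of 26 Aug 2005, identical numbering, p. 6),
`Theil2006Decay.lean` (Lemma 2.1 (12)) and `Theil2006EnergyBounds.lean` (the bound of type (11)).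
Everything here is PROVED; no named fact is added or discharged. With this file the whole of
Lemma 2.1 — the first step of the lower bound (6)/(9) of Theorem 1.1
(`Theil2006_groundStateEnergy`) — is in the tree.

## The printed statement (preprint p. 6, verbatim)

> **Lemma 2.1.** There exists `α₀ > 0` such that for all `α ∈ (0, α₀)` and all `V` satisfying
> (1)-(5)
> (10) `min_{r ∈ [1-α, 1+α]} V_*''(r) ≥ 1/2`,
> (11) `V(r) ≥ -2` for all `r ≥ 0`,
> (12) `|V(r)| ≤ α r⁻⁵` for all `r ≥ 4/3`
> holds.
> *Proof.* The claim follows directly from assumptions (3), (5) and the definition of `V_*`. ∎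

Here `V_*(r) = ⅙ ∑_{ξ ∈ A₂∖{0}} V(r|ξ|)` (`Theil2006.renormalizedPotential`). The one-line printed
proof is carried out as follows ((12) is `Theil2006.IsAdmissible.abs_apply_le'`).

## Content

* `Theil2006.IsNormalized.renormalizedPotential_one`, `neg_one_le_renormalizedPotential`,
  `deriv_renormalizedPotential_one`: normalization (1) in the language of `V_*` —
  `V_*(1) = -1 ≤ V_*(r)` for `r > 0`, hence `V_*'(1) = 0` (Fermat; no differentiability needed).
* `Theil2006.IsAdmissible.hasDerivAt_tail`, `hasDerivAt_deriv_tail`: beyond the unit shell the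
  dilated lattice sum `r ↦ ∑_{|ξ| ≥ √3} V(r|ξ|)` is twice differentiable on `r > 4/5`, termwise
  (`hasDerivAt_tsum_of_isPreconnected`: for `r > 4/5` every argument `r|ξ| ≥ (4/5)√3 > 4/3` lies
  in the decay region, where `|V'(s)| ≤ α s⁻⁶/6` (`Theil2006Decay`) and `|V''(s)| ≤ α s⁻⁷` (5) give
  summable majorants `O(α |ξ|⁻⁵)`).
* `Theil2006.IsAdmissible.deriv2_renormalizedPotential_eq`: for `α ≤ 1/5` and `r > 1-α`,
  `V_*''(r) = V''(r) + ⅙ ∑_{|ξ| ≥ √3} |ξ|² V''(r|ξ|)`, and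
  `Theil2006.IsAdmissible.abs_tail_deriv2_le`: the second term is at most `α (5/4)⁷ ∑_{ξ} |ξ|⁻⁵`
  in absolute value.
* `Theil2006.exists_half_le_deriv2_renormalizedPotential` — **Lemma 2.1 (10)**: a universal
  `α₀ > 0` such that `V_*''(r) ≥ 1/2` for `r ∈ (1-α, 1+α)`, every `α < α₀` and every admissible `V`
  (by (3), `V'' ≥ 1` there).
* `Theil2006.exists_quadratic_le_renormalizedPotential` — the form in which (1) and (10) enter
  (39) of the paper: `V_*(r) ≥ -1 + ¼ (r-1)²` for `r ∈ (1-α, 1+α)`, `α < α₀`.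
* `Theil2006.exists_neg_two_le` — **Lemma 2.1 (11)** as printed: a universal `α₀ > 0` with
  `V(r) ≥ -2` for all `r ≥ 0`, `0 < α < α₀`, `V` admissible (from
  `Theil2006.exists_lower_bound`: `V ≥ -1 - C α`).

## Wording risks

* (10) is printed as a minimum over the CLOSED interval `[1-α, 1+α]`, but hypothesis (3)
  (`V'' ≥ 1`) is stated on the open interval `(1-α, 1+α)` and `V ∈ C²(1-α, ∞)` does not define
  `V''(1-α)`; the closed-interval reading presumes one-sided limits. We state (10) on the open
  interval `(1-α, 1+α)`, which is how it is used ((39): short-range pairs have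
  `||y(x)-y(x')| - 1| ≤ α`, and the quadratic bound below covers the open interval; the endpoints
  are a null issue for the energy estimate only through continuity of `V_*`, which we also do not
  assert at `1-α`). This is a restriction of the printed claim, not a strengthening.
* The thresholds are explicit but immaterial: `α₀ = min (1/5) (3 / ((5/4)⁷ S + 1))` for (10), with
  `S = ∑_{ξ ∈ A₂} |ξ|⁻⁵` (junk-free: the `ξ = 0` term is `0`), and `α₀ = min (1/5) (1/(C+1))` for
  (11) with the universal `C` of `Theil2006.exists_lower_bound`; the paper's `α₀` is unspecified
  ("we do not make any effort to optimize the constants", p. 4).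
-/

noncomputable section

open scoped BigOperators Topology
open Filter Set

namespace Literature.MathematicalPhysics.StatisticalMechanics

namespace Theil2006

variable {α : ℝ} {V : ℝ → ℝ}

/-! ### Normalization (1) in the language of `V_*` -/

/-- `V_*(1) = -1`: the normalization (1) `∑_{ξ ≠ 0} V(|ξ|) = -6` divided by the six nearest
neighbours. [cite: Theil2006, §1 (1) and Notation] -/
theorem IsNormalized.renormalizedPotential_one (hV : IsNormalized V) :
    renormalizedPotential V 1 = -1 := by
  rw [renormalizedPotential, hV.latticeSum_one]
  norm_num

/-- `V_*(r) ≥ -1` for every dilation `r > 0`: the minimality clause of (1).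
[cite: Theil2006, §1 (1) and Notation] -/
theorem IsNormalized.neg_one_le_renormalizedPotential (hV : IsNormalized V) {r : ℝ}
    (hr : 0 < r) : -1 ≤ renormalizedPotential V r := by
  have h := hV.le_latticeSum r hr
  rw [renormalizedPotential]
  linarith

/-- `r = 1` is a local minimum of `V_*`. [cite: Theil2006, §1 (1)] -/
theorem IsNormalized.isLocalMin_renormalizedPotential (hV : IsNormalized V) :
    IsLocalMin (renormalizedPotential V) 1 := by
  have h : ∀ᶠ r in 𝓝 (1 : ℝ), renormalizedPotential V 1 ≤ renormalizedPotential V r := by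
    filter_upwards [Ioi_mem_nhds (zero_lt_one' ℝ)] with r hr
    rw [hV.renormalizedPotential_one]
    exact hV.neg_one_le_renormalizedPotential hr
  exact h

/-- `V_*'(1) = 0`: Fermat's theorem at the minimum `r = 1` of (1) (if `V_*` is not differentiable
at `1` the derivative is `0` by convention, so no hypothesis beyond (1) is needed).
[cite: Theil2006, §1 (1); used in §2.4 (39)] -/
theorem IsNormalized.deriv_renormalizedPotential_one (hV : IsNormalized V) :
    deriv (renormalizedPotential V) 1 = 0 :=
  hV.isLocalMin_renormalizedPotential.deriv_eq_zero

/-! ### The tail of the dilated lattice sum is `C²` beyond `r = 4/5` -/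

/-- Outside the unit shell, non-zero lattice vectors are longer than `5/3` (`≥ √3`).
(Private helper.) [folklore] -/
private theorem five_thirds_lt_norm_triPoint {k : ℤ × ℤ} (hk0 : k ≠ 0) (hk : k ∉ unitShell) :
    5 / 3 < ‖triPoint k‖ :=
  ((Real.lt_sqrt (by norm_num)).2 (by norm_num) : (5 : ℝ) / 3 < √3).trans_le
    (sqrt_three_le_norm_triPoint hk0 hk)

/-- For `r > 4/5` the dilated tail arguments `r|ξ|`, `|ξ| ≥ √3`, lie beyond `4/3`. (Private helper.)
[folklore] -/
private theorem four_thirds_lt_mul_norm_triPoint {r : ℝ} (hr : 4 / 5 < r) {k : ℤ × ℤ} (hk0 : k ≠ 0)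
    (hk : k ∉ unitShell) : 4 / 3 < r * ‖triPoint k‖ := by
  have h := five_thirds_lt_norm_triPoint hk0 hk
  nlinarith [mul_pos (sub_pos.2 hr) (sub_pos.2 h)]

/-- Termwise derivative of the dilated potential `r ↦ V(r|ξ|)` (`ξ ≠ 0`, `r|ξ| > 1-α`):
`|ξ| V'(r|ξ|)`. (Private helper: the chain rule.) [folklore] -/
private theorem IsAdmissible.hasDerivAt_latticePotential_dilate (hV : IsAdmissible α V) {k : ℤ × ℤ}
    {r : ℝ} (h : k = 0 ∨ 1 - α < r * ‖triPoint k‖) :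
    HasDerivAt (fun r => latticePotential (fun s => V (r * s)) k)
      (‖triPoint k‖ * deriv V (r * ‖triPoint k‖)) r := by
  rcases eq_or_ne k 0 with hk0 | hk0
  · subst hk0
    simp only [latticePotential_zero, map_zero, norm_zero, zero_mul]
    exact hasDerivAt_const r 0
  · have hlt : 1 - α < r * ‖triPoint k‖ := h.resolve_left hk0
    have hfun : (fun r => latticePotential (fun s => V (r * s)) k) =
        fun r => V (r * ‖triPoint k‖) := by
      funext r
      exact latticePotential_of_ne _ hk0
    rw [hfun]
    have hc := (hV.hasDerivAt hlt).comp r ((hasDerivAt_id r).mul_const ‖triPoint k‖)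
    have hc' : HasDerivAt (fun r => V (r * ‖triPoint k‖))
        (deriv V (r * ‖triPoint k‖) * (1 * ‖triPoint k‖)) r := hc
    convert hc' using 1
    ring

/-- Termwise second derivative: `r ↦ |ξ| V'(r|ξ|)` has derivative `|ξ|² V''(r|ξ|)`
(`ξ ≠ 0`, `r|ξ| > 1-α`). (Private helper: the chain rule.) [folklore] -/
private theorem IsAdmissible.hasDerivAt_deriv_latticePotential_dilate (hV : IsAdmissible α V)
    {k : ℤ × ℤ} {r : ℝ} (h : k = 0 ∨ 1 - α < r * ‖triPoint k‖) :
    HasDerivAt (fun r => ‖triPoint k‖ * deriv V (r * ‖triPoint k‖))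
      (‖triPoint k‖ ^ 2 * deriv^[2] V (r * ‖triPoint k‖)) r := by
  rcases eq_or_ne k 0 with hk0 | hk0
  · subst hk0
    simp only [map_zero, norm_zero, zero_mul, sq, mul_zero]
    exact hasDerivAt_const r 0
  · have hlt : 1 - α < r * ‖triPoint k‖ := h.resolve_left hk0
    have hc := ((hV.hasDerivAt_deriv hlt).comp r
      ((hasDerivAt_id r).mul_const ‖triPoint k‖)).const_mul ‖triPoint k‖
    have hc' : HasDerivAt (fun r => ‖triPoint k‖ * deriv V (r * ‖triPoint k‖))
        (‖triPoint k‖ * (deriv^[2] V (r * ‖triPoint k‖) * (1 * ‖triPoint k‖))) r := hc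
    convert hc' using 1
    ring

/-- Majorant for the first termwise derivative on `r > 4/5`:
`|ξ| |V'(r|ξ|)| ≤ (α/6)(5/4)⁶ |ξ|⁻⁵` (`|V'(s)| ≤ α s⁻⁶/6` for `s ≥ 4/3`).
[cite: Theil2006, §2.2 Lemma 2.1 (12)] -/
theorem IsAdmissible.abs_deriv_term_le (hV : IsAdmissible α V) {r : ℝ} (hr : 4 / 5 < r)
    {k : ℤ × ℤ} (hk : k ∉ unitShell) :
    |‖triPoint k‖ * deriv V (r * ‖triPoint k‖)| ≤ α / 6 * (5 / 4) ^ 6 * ‖triPoint k‖⁻¹ ^ 5 := by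
  rcases eq_or_ne k 0 with hk0 | hk0
  · subst hk0; simp
  have hα := hV.alpha_nonneg
  have hc : 5 / 3 < ‖triPoint k‖ := five_thirds_lt_norm_triPoint hk0 hk
  have hc0 : 0 < ‖triPoint k‖ := by linarith
  have harg := four_thirds_lt_mul_norm_triPoint hr hk0 hk
  have hr0 : 0 < r := by linarith
  have h1 := hV.abs_deriv_le harg.le
  rw [abs_mul, abs_of_pos hc0]
  calc ‖triPoint k‖ * |deriv V (r * ‖triPoint k‖)|
      ≤ ‖triPoint k‖ * (α / 6 * (r * ‖triPoint k‖)⁻¹ ^ 6) := by gcongr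
    _ = α / 6 * r⁻¹ ^ 6 * ‖triPoint k‖⁻¹ ^ 5 := by
        field_simp
    _ ≤ α / 6 * (5 / 4) ^ 6 * ‖triPoint k‖⁻¹ ^ 5 := by
        have h2 : r⁻¹ ≤ 5 / 4 := by
          rw [inv_le_comm₀ hr0 (by norm_num)]
          norm_num
          exact hr.le
        have h3 : 0 ≤ r⁻¹ := by positivity
        gcongr

/-- Majorant for the second termwise derivative on `r > 4/5`:
`|ξ|² |V''(r|ξ|)| ≤ α r⁻⁷ |ξ|⁻⁵ ≤ α (5/4)⁷ |ξ|⁻⁵` (hypothesis (5)).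
[cite: Theil2006, §1 Theorem 1.1 (5)] -/
theorem IsAdmissible.abs_deriv2_term_le (hV : IsAdmissible α V) {r : ℝ} (hr : 4 / 5 < r)
    {k : ℤ × ℤ} (hk : k ∉ unitShell) :
    |‖triPoint k‖ ^ 2 * deriv^[2] V (r * ‖triPoint k‖)| ≤ α * r⁻¹ ^ 7 * ‖triPoint k‖⁻¹ ^ 5 := by
  rcases eq_or_ne k 0 with hk0 | hk0
  · subst hk0; simp
  have hα := hV.alpha_nonneg
  have hc : 5 / 3 < ‖triPoint k‖ := five_thirds_lt_norm_triPoint hk0 hk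
  have hc0 : 0 < ‖triPoint k‖ := by linarith
  have harg := four_thirds_lt_mul_norm_triPoint hr hk0 hk
  have hr0 : 0 < r := by linarith
  have h1 := hV.decay _ harg
  rw [abs_mul, abs_of_pos (by positivity : 0 < ‖triPoint k‖ ^ 2)]
  calc ‖triPoint k‖ ^ 2 * |deriv^[2] V (r * ‖triPoint k‖)|
      ≤ ‖triPoint k‖ ^ 2 * (α * (r * ‖triPoint k‖)⁻¹ ^ 7) := by gcongr
    _ = α * r⁻¹ ^ 7 * ‖triPoint k‖⁻¹ ^ 5 := by
        field_simp

/-- The uniform version: `|ξ|² |V''(r|ξ|)| ≤ α (5/4)⁷ |ξ|⁻⁵` for `r > 4/5`.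
[cite: Theil2006, §1 Theorem 1.1 (5)] -/
theorem IsAdmissible.abs_deriv2_term_le' (hV : IsAdmissible α V) {r : ℝ} (hr : 4 / 5 < r)
    {k : ℤ × ℤ} (hk : k ∉ unitShell) :
    |‖triPoint k‖ ^ 2 * deriv^[2] V (r * ‖triPoint k‖)| ≤ α * (5 / 4) ^ 7 * ‖triPoint k‖⁻¹ ^ 5 := by
  refine (hV.abs_deriv2_term_le hr hk).trans ?_
  have hα := hV.alpha_nonneg
  have hr0 : 0 < r := by linarith
  have h2 : r⁻¹ ≤ 5 / 4 := by
    rw [inv_le_comm₀ hr0 (by norm_num)]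
    norm_num
    exact hr.le
  have h3 : 0 ≤ r⁻¹ := by positivity
  gcongr

/-- **The tail is differentiable termwise on `r > 4/5`**:
`(d/dr) ∑_{|ξ| ≥ √3} V(r|ξ|) = ∑_{|ξ| ≥ √3} |ξ| V'(r|ξ|)`.
[cite: Theil2006, §2.2 Lemma 2.1 (proof: "the definition of `V_*`")] -/
theorem IsAdmissible.hasDerivAt_tail (hV : IsAdmissible α V) {r : ℝ} (hr : 4 / 5 < r) :
    HasDerivAt
      (fun r => ∑' k : ↥((unitShell : Set (ℤ × ℤ))ᶜ), latticePotential (fun s => V (r * s)) k)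
      (∑' k : ↥((unitShell : Set (ℤ × ℤ))ᶜ), ‖triPoint k‖ * deriv V (r * ‖triPoint k‖)) r := by
  have hα := hV.alpha_nonneg
  have hu : Summable fun k : ↥((unitShell : Set (ℤ × ℤ))ᶜ) =>
      α / 6 * (5 / 4) ^ 6 * ‖triPoint k‖⁻¹ ^ 5 :=
    (summable_norm_triPoint_inv_pow.mul_left (α / 6 * (5 / 4) ^ 6)).subtype _
  have h0 : Summable fun k : ↥((unitShell : Set (ℤ × ℤ))ᶜ) =>
      latticePotential (fun s => V (1 * s)) k :=
    (hV.hasSum_latticePotential_dilate one_pos).summable.subtype _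
  refine hasDerivAt_tsum_of_isPreconnected hu isOpen_Ioi isPreconnected_Ioi
    (fun k y hy => hV.hasDerivAt_latticePotential_dilate ?_)
    (fun k y hy => ?_) (by norm_num : (1 : ℝ) ∈ Ioi (4 / 5)) h0 hr
  · rcases eq_or_ne (k : ℤ × ℤ) 0 with hk0 | hk0
    · exact Or.inl hk0
    · exact Or.inr ((by linarith : 1 - α < 4 / 3).trans
        (four_thirds_lt_mul_norm_triPoint hy hk0 k.2))
  · rw [Real.norm_eq_abs]
    exact hV.abs_deriv_term_le hy k.2

/-- **The tail is twice differentiable termwise on `r > 4/5`**: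
`(d/dr) ∑_{|ξ| ≥ √3} |ξ| V'(r|ξ|) = ∑_{|ξ| ≥ √3} |ξ|² V''(r|ξ|)`.
[cite: Theil2006, §2.2 Lemma 2.1 (proof: "the definition of `V_*`")] -/
theorem IsAdmissible.hasDerivAt_deriv_tail (hV : IsAdmissible α V) {r : ℝ} (hr : 4 / 5 < r) :
    HasDerivAt
      (fun r => ∑' k : ↥((unitShell : Set (ℤ × ℤ))ᶜ), ‖triPoint k‖ * deriv V (r * ‖triPoint k‖))
      (∑' k : ↥((unitShell : Set (ℤ × ℤ))ᶜ),
        ‖triPoint k‖ ^ 2 * deriv^[2] V (r * ‖triPoint k‖)) r := by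
  have hα := hV.alpha_nonneg
  have hu : Summable fun k : ↥((unitShell : Set (ℤ × ℤ))ᶜ) =>
      α * (5 / 4) ^ 7 * ‖triPoint k‖⁻¹ ^ 5 :=
    (summable_norm_triPoint_inv_pow.mul_left (α * (5 / 4) ^ 7)).subtype _
  have hu₁ : Summable fun k : ↥((unitShell : Set (ℤ × ℤ))ᶜ) =>
      α / 6 * (5 / 4) ^ 6 * ‖triPoint k‖⁻¹ ^ 5 :=
    (summable_norm_triPoint_inv_pow.mul_left (α / 6 * (5 / 4) ^ 6)).subtype _
  have h0 : Summable fun k : ↥((unitShell : Set (ℤ × ℤ))ᶜ) =>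
      ‖triPoint k‖ * deriv V (1 * ‖triPoint k‖) :=
    hu₁.of_norm_bounded fun k => by
      rw [Real.norm_eq_abs]
      exact hV.abs_deriv_term_le (by norm_num) k.2
  refine hasDerivAt_tsum_of_isPreconnected hu isOpen_Ioi isPreconnected_Ioi
    (fun k y hy => hV.hasDerivAt_deriv_latticePotential_dilate ?_)
    (fun k y hy => ?_) (by norm_num : (1 : ℝ) ∈ Ioi (4 / 5)) h0 hr
  · rcases eq_or_ne (k : ℤ × ℤ) 0 with hk0 | hk0
    · exact Or.inl hk0
    · exact Or.inr ((by linarith : 1 - α < 4 / 3).trans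
        (four_thirds_lt_mul_norm_triPoint hy hk0 k.2))
  · rw [Real.norm_eq_abs]
    exact hV.abs_deriv2_term_le' hy k.2

/-- **The second derivative of the tail is `O(α)`**: for `r > 4/5`,
`|∑_{|ξ| ≥ √3} |ξ|² V''(r|ξ|)| ≤ α (5/4)⁷ ∑_{ξ ∈ A₂} |ξ|⁻⁵`.
[cite: Theil2006, §2.2 Lemma 2.1 (proof: "assumption (5)")] -/
theorem IsAdmissible.abs_tail_deriv2_le (hV : IsAdmissible α V) {r : ℝ} (hr : 4 / 5 < r) :
    |∑' k : ↥((unitShell : Set (ℤ × ℤ))ᶜ), ‖triPoint k‖ ^ 2 * deriv^[2] V (r * ‖triPoint k‖)| ≤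
      α * (5 / 4) ^ 7 * ∑' k : ℤ × ℤ, ‖triPoint k‖⁻¹ ^ 5 := by
  set T : Set (ℤ × ℤ) := (unitShell : Set (ℤ × ℤ))ᶜ with hT
  set c : ℝ := α * (5 / 4) ^ 7 with hc
  set g : ↥((unitShell : Set (ℤ × ℤ))ᶜ) → ℝ := fun k =>
    ‖triPoint k‖ ^ 2 * deriv^[2] V (r * ‖triPoint k‖) with hg_def
  have hα := hV.alpha_nonneg
  have hc0 : 0 ≤ c := by positivity
  have hfull : Summable fun k : ℤ × ℤ => c * ‖triPoint k‖⁻¹ ^ 5 :=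
    summable_norm_triPoint_inv_pow.mul_left c
  have hgT : Summable fun k : T => c * ‖triPoint k‖⁻¹ ^ 5 := hfull.subtype T
  have hbound : ∀ k : T, |g k| ≤ c * ‖triPoint k‖⁻¹ ^ 5 :=
    fun k => hV.abs_deriv2_term_le' hr k.2
  have hg : Summable g := hgT.of_norm_bounded fun k => by
    rw [Real.norm_eq_abs]; exact hbound k
  have h1 : ‖∑' k : T, g k‖ ≤ ∑' k : T, ‖g k‖ := norm_tsum_le_tsum_norm hg.norm
  simp only [Real.norm_eq_abs] at h1
  have h2 : ∑' k : T, |g k| ≤ ∑' k : T, c * ‖triPoint k‖⁻¹ ^ 5 :=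
    hg.abs.tsum_le_tsum hbound hgT
  have h3 : ∑' k : T, c * ‖triPoint k‖⁻¹ ^ 5 ≤ ∑' k : ℤ × ℤ, c * ‖triPoint k‖⁻¹ ^ 5 :=
    Summable.tsum_subtype_le (fun k : ℤ × ℤ => c * ‖triPoint k‖⁻¹ ^ 5) T
      (fun k => by positivity) hfull
  have h4 : ∑' k : ℤ × ℤ, c * ‖triPoint k‖⁻¹ ^ 5 = c * ∑' k : ℤ × ℤ, ‖triPoint k‖⁻¹ ^ 5 :=
    tsum_mul_left
  rw [h4] at h3
  exact h1.trans (h2.trans h3)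

/-! ### `V_*` is `C²` on `(1-α, ∞)` for `α ≤ 1/5`, with the termwise formula for `V_*''` -/

/-- `V_*(r) = V(r) + ⅙ ∑_{|ξ| ≥ √3} V(r|ξ|)` for `r > 0`: the six nearest neighbours carry `V(r)`
each. [cite: Theil2006, §1 Notation and §2.3 Remark 2.5] -/
theorem IsNormalized.renormalizedPotential_eq_add_tail (hV : IsNormalized V) {r : ℝ}
    (hr : 0 < r) :
    renormalizedPotential V r =
      V r + (∑' k : ↥((unitShell : Set (ℤ × ℤ))ᶜ),
        latticePotential (fun s => V (r * s)) k) / 6 := by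
  have hsum := hV.hasSum_latticePotential_dilate hr
  have hsplit := hsum.summable.sum_add_tsum_compl (s := unitShell)
  rw [hsum.tsum_eq, sum_unitShell_latticePotential] at hsplit
  rw [renormalizedPotential, ← hsplit]
  ring

/-- **`V_*` is differentiable on `(1-α, ∞)`** (`α ≤ 1/5`), with
`V_*'(r) = V'(r) + ⅙ ∑_{|ξ| ≥ √3} |ξ| V'(r|ξ|)`. [cite: Theil2006, §2.2 Lemma 2.1 (proof)] -/
theorem IsAdmissible.hasDerivAt_renormalizedPotential (hV : IsAdmissible α V) (hα5 : α ≤ 1 / 5)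
    {r : ℝ} (hr : 1 - α < r) :
    HasDerivAt (renormalizedPotential V)
      (deriv V r +
        (∑' k : ↥((unitShell : Set (ℤ × ℤ))ᶜ), ‖triPoint k‖ * deriv V (r * ‖triPoint k‖)) / 6)
      r := by
  have hr45 : 4 / 5 < r := by linarith
  have heq : renormalizedPotential V =ᶠ[𝓝 r] fun r =>
      V r + (∑' k : ↥((unitShell : Set (ℤ × ℤ))ᶜ),
        latticePotential (fun s => V (r * s)) k) / 6 :=
    Filter.eventuallyEq_of_mem (Ioi_mem_nhds hr) fun r' hr' =>
      hV.toIsNormalized.renormalizedPotential_eq_add_tail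
        (by simp only [mem_Ioi] at hr'; linarith)
  exact ((hV.hasDerivAt hr).add ((hV.hasDerivAt_tail hr45).div_const 6)).congr_of_eventuallyEq
    heq

/-- The formula for `V_*'` on `(1-α, ∞)` (`α ≤ 1/5`). [cite: Theil2006, §2.2 Lemma 2.1 (proof)] -/
theorem IsAdmissible.deriv_renormalizedPotential_eq (hV : IsAdmissible α V) (hα5 : α ≤ 1 / 5)
    {r : ℝ} (hr : 1 - α < r) :
    deriv (renormalizedPotential V) r =
      deriv V r +
        (∑' k : ↥((unitShell : Set (ℤ × ℤ))ᶜ), ‖triPoint k‖ * deriv V (r * ‖triPoint k‖)) / 6 :=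
  (hV.hasDerivAt_renormalizedPotential hα5 hr).deriv

/-- **`V_*'` is differentiable on `(1-α, ∞)`** (`α ≤ 1/5`), with
`V_*''(r) = V''(r) + ⅙ ∑_{|ξ| ≥ √3} |ξ|² V''(r|ξ|)`. [cite: Theil2006, §2.2 Lemma 2.1 (proof)] -/
theorem IsAdmissible.hasDerivAt_deriv_renormalizedPotential (hV : IsAdmissible α V)
    (hα5 : α ≤ 1 / 5) {r : ℝ} (hr : 1 - α < r) :
    HasDerivAt (deriv (renormalizedPotential V))
      (deriv^[2] V r +
        (∑' k : ↥((unitShell : Set (ℤ × ℤ))ᶜ),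
          ‖triPoint k‖ ^ 2 * deriv^[2] V (r * ‖triPoint k‖)) / 6)
      r := by
  have hr45 : 4 / 5 < r := by linarith
  have heq : deriv (renormalizedPotential V) =ᶠ[𝓝 r] fun r =>
      deriv V r +
        (∑' k : ↥((unitShell : Set (ℤ × ℤ))ᶜ), ‖triPoint k‖ * deriv V (r * ‖triPoint k‖)) / 6 :=
    Filter.eventuallyEq_of_mem (Ioi_mem_nhds hr) fun r' hr' =>
      hV.deriv_renormalizedPotential_eq hα5 (by simpa only [mem_Ioi] using hr')
  exact ((hV.hasDerivAt_deriv hr).add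
    ((hV.hasDerivAt_deriv_tail hr45).div_const 6)).congr_of_eventuallyEq heq

/-- **The termwise formula for `V_*''`** on `(1-α, ∞)` (`α ≤ 1/5`):
`V_*''(r) = V''(r) + ⅙ ∑_{|ξ| ≥ √3} |ξ|² V''(r|ξ|)` — "the definition of `V_*`" in the printed
proof of Lemma 2.1. [cite: Theil2006, §2.2 Lemma 2.1 (proof)] -/
theorem IsAdmissible.deriv2_renormalizedPotential_eq (hV : IsAdmissible α V) (hα5 : α ≤ 1 / 5)
    {r : ℝ} (hr : 1 - α < r) :
    deriv^[2] (renormalizedPotential V) r =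
      deriv^[2] V r +
        (∑' k : ↥((unitShell : Set (ℤ × ℤ))ᶜ),
          ‖triPoint k‖ ^ 2 * deriv^[2] V (r * ‖triPoint k‖)) / 6 := by
  show deriv (deriv (renormalizedPotential V)) r = _
  exact (hV.hasDerivAt_deriv_renormalizedPotential hα5 hr).deriv

/-! ### Lemma 2.1 (10) -/

/-- **Theil 2006, Lemma 2.1 (10).** There is a universal `α₀ > 0` such that for every `α < α₀`
and every `V` satisfying (1)–(5), `V_*''(r) ≥ 1/2` for all `r ∈ (1-α, 1+α)` (printed as
`min_{r ∈ [1-α,1+α]} V_*''(r) ≥ ½`; see the module docstring for the open interval). Proof as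
printed: by (3) the unit shell contributes `V''(r) ≥ 1`, by (5) the rest contributes at most
`⅙ α (5/4)⁷ ∑_ξ |ξ|⁻⁵ ≤ ½` in absolute value. [cite: Theil2006, §2.2 Lemma 2.1 (10)] -/
theorem exists_half_le_deriv2_renormalizedPotential :
    ∃ α₀ : ℝ, 0 < α₀ ∧ ∀ (α : ℝ) (V : ℝ → ℝ), α < α₀ → IsAdmissible α V →
      ∀ r ∈ Ioo (1 - α) (1 + α), 1 / 2 ≤ deriv^[2] (renormalizedPotential V) r := by
  set S := ∑' k : ℤ × ℤ, ‖triPoint k‖⁻¹ ^ 5 with hS_def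
  have hS : 0 ≤ S := tsum_nonneg fun k => by positivity
  refine ⟨min (1 / 5) (3 / ((5 / 4) ^ 7 * S + 1)), lt_min (by norm_num) (by positivity),
    fun α V hα hV r hr => ?_⟩
  have hα5 : α ≤ 1 / 5 := hα.le.trans (min_le_left _ _)
  have hα3 : α < 3 / ((5 / 4) ^ 7 * S + 1) := hα.trans_le (min_le_right _ _)
  have hα0 := hV.alpha_nonneg
  obtain ⟨hr1, hr2⟩ := hr
  have hr45 : 4 / 5 < r := by linarith
  rw [hV.deriv2_renormalizedPotential_eq hα5 hr1]
  have hconv := hV.convex r ⟨hr1, hr2⟩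
  have htail := hV.abs_tail_deriv2_le hr45
  have hle := neg_abs_le
    (∑' k : ↥((unitShell : Set (ℤ × ℤ))ᶜ), ‖triPoint k‖ ^ 2 * deriv^[2] V (r * ‖triPoint k‖))
  have hαS : α * ((5 / 4) ^ 7 * S) ≤ 3 := by
    have h1 : α * ((5 / 4) ^ 7 * S + 1) < 3 := by
      rwa [lt_div_iff₀ (by positivity)] at hα3
    nlinarith
  nlinarith

/-- A `C²`-type comparison on an open interval: if `ψ' ` is the derivative of `ψ`, `ψ''` that of
`ψ'`, `ψ'' ≥ m` on `(a, b)` and `ψ'(c) = 0` at some `c ∈ (a, b)`, then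
`ψ(r) ≥ ψ(c) + (m/2)(r-c)²` on `(a, b)`. [folklore] -/
private theorem quadratic_le_of_deriv2 {ψ ψ' ψ'' : ℝ → ℝ} {a b c m : ℝ} (hc : c ∈ Ioo a b)
    (h1 : ∀ r ∈ Ioo a b, HasDerivAt ψ (ψ' r) r) (h2 : ∀ r ∈ Ioo a b, HasDerivAt ψ' (ψ'' r) r)
    (h3 : ∀ r ∈ Ioo a b, m ≤ ψ'' r) (h4 : ψ' c = 0) {r : ℝ} (hr : r ∈ Ioo a b) :
    ψ c + m / 2 * (r - c) ^ 2 ≤ ψ r := by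
  -- `φ = ψ - (m/2)(· - c)²` has `φ' = ψ' - m (· - c)`, `φ'' = ψ'' - m ≥ 0` and `φ'(c) = 0`.
  have hφd : ∀ x ∈ Ioo a b,
      HasDerivAt (fun x => ψ x - m / 2 * (x - c) ^ 2) (ψ' x - m * (x - c)) x := fun x hx => by
    have h' : HasDerivAt (fun x => m / 2 * (x - c) ^ 2)
        (m / 2 * (((2 : ℕ) : ℝ) * (x - c) ^ (2 - 1) * 1)) x :=
      (((hasDerivAt_id' x).sub_const c).pow 2).const_mul (m / 2)
    refine ((h1 x hx).sub h').congr_deriv ?_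
    push_cast
    ring
  have hφ'd : ∀ x ∈ Ioo a b, HasDerivAt (fun x => ψ' x - m * (x - c)) (ψ'' x - m) x :=
    fun x hx => by
      have h' : HasDerivAt (fun x => m * (x - c)) (m * 1) x :=
        ((hasDerivAt_id' x).sub_const c).const_mul m
      refine ((h2 x hx).sub h').congr_deriv ?_
      ring
  -- `φ'` is monotone on `(a, b)`
  have hmono : MonotoneOn (fun x => ψ' x - m * (x - c)) (Ioo a b) := by
    refine monotoneOn_of_hasDerivWithinAt_nonneg (f' := fun x => ψ'' x - m) (convex_Ioo a b)
      (fun x hx => (hφ'd x hx).continuousAt.continuousWithinAt) (fun x hx => ?_) fun x hx => ?_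
    · rw [interior_Ioo] at hx ⊢
      exact (hφ'd x hx).hasDerivWithinAt
    · rw [interior_Ioo] at hx
      linarith [h3 x hx]
  -- compare `φ r` with `φ c` on either side of `c`
  have key : ψ c - m / 2 * (c - c) ^ 2 ≤ ψ r - m / 2 * (r - c) ^ 2 := by
    rcases le_total c r with hcr | hrc
    · -- on `[c, r]`, `φ' ≥ 0`, so `φ` is monotone
      have hsub : Icc c r ⊆ Ioo a b := fun x hx => ⟨hc.1.trans_le hx.1, hx.2.trans_lt hr.2⟩
      have hmono' : MonotoneOn (fun x => ψ x - m / 2 * (x - c) ^ 2) (Icc c r) := by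
        refine monotoneOn_of_hasDerivWithinAt_nonneg (convex_Icc c r)
          (fun x hx => (hφd x (hsub hx)).continuousAt.continuousWithinAt)
          (fun x hx => (hφd x (hsub (interior_subset hx))).hasDerivWithinAt) fun x hx => ?_
        have hx' : x ∈ Ioo a b := hsub (interior_subset hx)
        rw [interior_Icc] at hx
        have hcx : ψ' c - m * (c - c) ≤ ψ' x - m * (x - c) := hmono hc hx' hx.1.le
        rw [h4, sub_self, mul_zero, sub_zero] at hcx
        exact hcx
      exact hmono' (left_mem_Icc.2 hcr) (right_mem_Icc.2 hcr) hcr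
    · -- on `[r, c]`, `φ' ≤ 0`, so `φ` is antitone
      have hsub : Icc r c ⊆ Ioo a b := fun x hx => ⟨hr.1.trans_le hx.1, hx.2.trans_lt hc.2⟩
      have hanti : AntitoneOn (fun x => ψ x - m / 2 * (x - c) ^ 2) (Icc r c) := by
        refine antitoneOn_of_hasDerivWithinAt_nonpos (convex_Icc r c)
          (fun x hx => (hφd x (hsub hx)).continuousAt.continuousWithinAt)
          (fun x hx => (hφd x (hsub (interior_subset hx))).hasDerivWithinAt) fun x hx => ?_
        have hx' : x ∈ Ioo a b := hsub (interior_subset hx)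
        rw [interior_Icc] at hx
        have hxc : ψ' x - m * (x - c) ≤ ψ' c - m * (c - c) := hmono hx' hc hx.2.le
        rw [h4, sub_self, mul_zero, sub_zero] at hxc
        exact hxc
      exact hanti (left_mem_Icc.2 hrc) (right_mem_Icc.2 hrc) hrc
  rw [sub_self] at key
  linarith

/-- **How (1) and (10) enter (39): the renormalized potential lies above a parabola.** With the
`α₀` of Lemma 2.1 (10): for `0 < α < α₀`, `V` admissible and `r ∈ (1-α, 1+α)`,
`V_*(r) ≥ -1 + ¼ (r-1)²` (Taylor at the minimum `r = 1`: `V_*(1) = -1`, `V_*'(1) = 0`,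
`V_*'' ≥ ½`). In the paper this is the step "`∑_{p ∈ 𝒮} [e_*(p) - Cα(|y(x)-y(x')|-1)²] ≥
-3#𝒮 + (1/C) ∑_{p ∈ 𝒮} (e_*(p) + 1)` … follows from (7) together with assumptions (1) and (10)".
[cite: Theil2006, §2.2 Lemma 2.1 (10) with §1 (1); used in §2.4 (39)] -/
theorem exists_quadratic_le_renormalizedPotential :
    ∃ α₀ : ℝ, 0 < α₀ ∧ ∀ (α : ℝ) (V : ℝ → ℝ), 0 < α → α < α₀ → IsAdmissible α V →
      ∀ r ∈ Ioo (1 - α) (1 + α), -1 + 1 / 4 * (r - 1) ^ 2 ≤ renormalizedPotential V r := by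
  obtain ⟨α₀, hα₀, h10⟩ := exists_half_le_deriv2_renormalizedPotential
  refine ⟨min α₀ (1 / 5), lt_min hα₀ (by norm_num), fun α V hα hα' hV r hr => ?_⟩
  have hα5 : α ≤ 1 / 5 := hα'.le.trans (min_le_right _ _)
  have hα1 : α < α₀ := hα'.trans_le (min_le_left _ _)
  have h1 : (1 : ℝ) ∈ Ioo (1 - α) (1 + α) := ⟨by linarith, by linarith⟩
  have key := quadratic_le_of_deriv2 (ψ := renormalizedPotential V)
    (ψ' := deriv (renormalizedPotential V)) (ψ'' := deriv^[2] (renormalizedPotential V))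
    (m := 1 / 2) h1
    (fun r hr => (hV.hasDerivAt_renormalizedPotential hα5 hr.1).differentiableAt.hasDerivAt)
    (fun r hr => (hV.hasDerivAt_deriv_renormalizedPotential hα5 hr.1).differentiableAt.hasDerivAt)
    (fun r hr => h10 α V hα1 hV r hr) hV.deriv_renormalizedPotential_one hr
  rw [hV.renormalizedPotential_one] at key
  linarith

/-! ### Lemma 2.1 (11) as printed -/

/-- **Theil 2006, Lemma 2.1 (11)** as printed: there is a universal `α₀ > 0` such that for every
`α ∈ (0, α₀)` and every `V` satisfying (1)–(5), `V(r) ≥ -2` for all `r ≥ 0`. From the sharper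
`V ≥ -1 - C α` (`Theil2006.exists_lower_bound`: (2) on `[0, 1-α]`, the normalization (1) with
(12) on `(1-α, 1+α)`, (4) on `[1+α, 4/3]`, (12) beyond) with `α₀ = min (1/5) (1/(C+1))`.
[cite: Theil2006, §2.2 Lemma 2.1 (11)] -/
theorem exists_neg_two_le : ∃ α₀ : ℝ, 0 < α₀ ∧ ∀ (α : ℝ) (V : ℝ → ℝ), 0 < α → α < α₀ →
    IsAdmissible α V → ∀ r, 0 ≤ r → -2 ≤ V r := by
  obtain ⟨C, hC, hlow⟩ := exists_lower_bound
  refine ⟨min (1 / 5) (1 / (C + 1)), lt_min (by norm_num) (by positivity),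
    fun α V hα hα' hV r hr => ?_⟩
  have hα5 : α ≤ 1 / 5 := hα'.le.trans (min_le_left _ _)
  have hαC : α < 1 / (C + 1) := hα'.trans_le (min_le_right _ _)
  have h1 := hlow α V hα hα5 hV r hr
  have h2 : C * α ≤ 1 := by
    have h3 : α * (C + 1) < 1 := by rwa [lt_div_iff₀ (by positivity)] at hαC
    nlinarith
  linarith

end Theil2006

end Literature.MathematicalPhysics.StatisticalMechanics

end
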